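import Mathlib
import Summits.NavierStokesRegularity.NavierStokesRegularity.Theorems.TypeIQuarterGateScarEnvelopeTypeIZoomDictionaryDefs
import Summits.NavierStokesRegularity.NavierStokesRegularity.Theorems.TypeIQuarterGateScarEnvelopeTypeIFatKill
import Summits.NavierStokesRegularity.NavierStokesRegularity.Theorems.TypeIQuarterGateScarEnvelopeTypeIBudgetViolators
import Summits.NavierStokesRegularity.NavierStokesRegularity.Theorems.TypeIQuarterGateScarEnvelopeTypeIOfNoTwinScarObject
import Summits.NavierStokesRegularity.NavierStokesRegularity.Theorems.TypeIQuarterGateQuarterLawTypeIGlue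
import Summits.NavierStokesRegularity.NavierStokesRegularity.Theorems.TypeIQuarterGateEnvelopeQuarterLaw
import Summits.NavierStokesRegularity.NavierStokesRegularity.Theorems.TypeIQuarterGateScarEnvelopeTypeINearOneRateDss
import Literature.Analysis.FluidPDE.AncientAxisymmetricTypeILiouville
import Summits.NavierStokesRegularity.NavierStokesRegularity.Theorems.TypeIQuarterGateScarEnvelopeTypeIZoomDictionaryLemmas
import Summits.NavierStokesRegularity.NavierStokesRegularity.Theorems.TypeIQuarterGateScarEnvelopeTypeIZoomDictionaryUnitInputs
import Summits.NavierStokesRegularity.NavierStokesRegularity.Theorems.TypeIQuarterGateScarEnvelopeTypeISatelliteTowerDefs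
import Summits.NavierStokesRegularity.NavierStokesRegularity.Theorems.TypeIQuarterGateScarEnvelopeTypeISatelliteTowerObjects
import Summits.NavierStokesRegularity.NavierStokesRegularity.Theorems.TypeIQuarterGateScarEnvelopeTypeISatelliteTowerEnvelopeStability
import Summits.NavierStokesRegularity.NavierStokesRegularity.Theorems.TypeIQuarterGateScarEnvelopeTypeISatelliteTowerEnvelopeLeaves

/-!
# Part M1–M3: THE ROOT METER — envelope failure ⇒ a tangent flow with a satellite on a prescribed sphere; NON-TAME ⟺ SPHERE SATELLITE

Part M1–M3 of the ROUND-33 plate (v7/v8): `exists_tangentU_sphere_of_not_envelope` (M1), the tower-frame form (M2) and ★ the root meter in the engine class: a final-time point of an A–B object is NON-TAME iff some tangent flow there has a singular point on EVERY prescribed sphere (M3).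

PROVENANCE: declaration texts VERBATIM from the HOME plates of the instrument seat nsreg-p3 (g24/g25, cell
`pub/ns-regularity-ideate`): `round-31/Tangent31prep.lean` v5 (sha16 `e5b8668e3a090216`; = ROUND-30 plate v10 + Part K) and,
for Part L, `round-32/Tangent32prep.lean` v6 (sha16 `6123f27718636121`); for Parts M/N, `round-34/Tangent34prep.lean`
v8 (sha16 `84f56c3bc8f4da24`; = v7 `922795f19cd5db01` + Part N);
the author cannot write under `Theorems/` (`perm.theorems-prover-only`); landed by the
LEAD-lineage prover ns-sz-p1 g5 on director-ns DIRECTOR-NS #218 (2), split into ≤ 400-line modules (the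
plate's `def`s gathered in `TypeIQuarterGateScarEnvelopeTypeIZoomDictionaryDefs`), namespace
`Summit.NavierStokesRegularity.NavierStokesRegularity.Cruxes.ScarEnvelopeTypeI.ZoomDictionary` (the plate's `NsregP3.R30P`), `E3` spelled out, one-line docstrings
added where the plate had none.  `--supports stmt-NavierStokesRegularity-23843 --as helper`.

HONEST FRAMING: dictionary / census TOOLING for the crux `TypeIQuarterGate.ScarEnvelopeTypeI` (item 23843):
equivalences and normal forms, kernel-checked; NO open statement is proved — 23843, its parent
`QuarterLawTypeI` (23726), the route and Navier–Stokes regularity are OPEN; hard core evaded: none.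
-/

-- the summit-side namespace repeats a component by design (single-conjunct summit, D-0017)
set_option linter.dupNamespace false

open MeasureTheory Set Metric Filter Topology
open scoped ENNReal

namespace Summit.NavierStokesRegularity.NavierStokesRegularity.Cruxes.ScarEnvelopeTypeI.ZoomDictionary

variable {u : ℝ → (EuclideanSpace ℝ (Fin 3)) → (EuclideanSpace ℝ (Fin 3))} {a : (EuclideanSpace ℝ (Fin 3))} {ν T : ℝ}

section Tower

open Literature.Analysis.FluidPDE
variable {U : ℝ → (EuclideanSpace ℝ (Fin 3)) → (EuclideanSpace ℝ (Fin 3))} {P : ℝ → (EuclideanSpace ℝ (Fin 3)) → ℝ} {y' : (EuclideanSpace ℝ (Fin 3))} {ν : ℝ}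
open Summit.NavierStokesRegularity.NavierStokesRegularity.Cruxes.ScarEnvelopeTypeI.ScarZoom
  (CruxHypotheses ScarViolators TwinScarObject singularAt_of_isBackwardSingularPoint
    exists_localEnergy_of_typeIBound) in

/-! #### M1. Envelope failure ⇒ a tangent flow with a satellite ON A PRESCRIBED SPHERE -/

/-- A point on the sphere `‖z‖ = κ⁻¹`, `κ > 1`, is a point of the punctured open unit ball. -/
theorem sphere_aux {κ : ℝ} (hκ : 1 < κ) {z : (EuclideanSpace ℝ (Fin 3))} (hz : ‖z‖ = κ⁻¹) : z ≠ 0 ∧ ‖z‖ < 1 := by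
  have hκ0 : 0 < κ := lt_trans one_pos hκ
  have hinv : 0 < κ⁻¹ := inv_pos.2 hκ0
  have hlt : κ⁻¹ < 1 := by
    have hmul : κ⁻¹ * κ = 1 := inv_mul_cancel₀ hκ0.ne'
    nlinarith
  refine ⟨fun h => ?_, by rw [hz]; exact hlt⟩
  have h1 : 0 < ‖z‖ := by rw [hz]; exact hinv
  rw [h, norm_zero] at h1
  exact lt_irrefl _ h1

/-- **NOT ENVELOPED ⇒ A SATELLITE ON THE SPHERE `‖z‖ = κ⁻¹` OF SOME TANGENT FLOW.**  Let `u` be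
continuous on `(0,T) × ℝ³` with the sup-norm Type-I rate on a final window, with small zooms at
`(a, T)` in A–B's class and bounded in `L³ × L^{3/2}`, and suppose the space–time Type-I envelope
FAILS at `(a, T)` (no `A, δ` with `‖u(t,x)‖ ≤ A/(‖x − a‖ + √(T − t))` on `(T − δ², T) × B(a, δ)`).
Then for every `κ > 1` some tangent flow `ū` of `u` at `(a, T)` is NOT essentially bounded near the
final-time point `(0, z)` for some `z` with `‖z‖ = κ⁻¹`.  (L2's proof run forward: the violators,
pushed outside the parabola by the rate and zoomed by `κ(‖x_k − a‖ + √(T − t_k))`, accumulate at a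
final-time point `(0, z)`, `‖z‖ = κ⁻¹`, of a tangent flow with zoom values `> κ(k+1)` — incompatible
with regularity at `z` by the stability of regular final-time points L1.) -/
theorem exists_tangentU_sphere_of_not_envelope {u : ℝ → (EuclideanSpace ℝ (Fin 3)) → (EuclideanSpace ℝ (Fin 3))} {p : ℝ → (EuclideanSpace ℝ (Fin 3)) → ℝ} {a : (EuclideanSpace ℝ (Fin 3))} {T : ℝ}
    (hT : 0 < T) (hcont : ContinuousOn (Function.uncurry u) (Ioo 0 T ×ˢ univ))
    {C δ₀ : ℝ} (hδ₀ : 0 < δ₀)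
    (hrate : ∀ t ∈ Ioo (T - δ₀) T, ∀ x, Real.sqrt (T - t) * ‖u t x‖ ≤ C)
    (hZ : ZoomsInBall u p a T) (hB : ZoomsBddU u p a T)
    (hne : ¬ ∃ A δ : ℝ, 0 < δ ∧ ∀ t ∈ Ioo (T - δ ^ 2) T, ∀ x ∈ ball a δ,
      ‖u t x‖ ≤ A / (‖x - a‖ + Real.sqrt (T - t)))
    {κ : ℝ} (hκ : 1 < κ) :
    ∃ (L : ℕ → ℝ) (ū : ℝ → (EuclideanSpace ℝ (Fin 3)) → (EuclideanSpace ℝ (Fin 3))), TangentU u p a T L ū ∧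
      ∃ z : (EuclideanSpace ℝ (Fin 3)), ‖z‖ = κ⁻¹ ∧ ¬ RegPt ū z := by
  push Not at hne
  have hκ0 : 0 < κ := lt_trans one_pos hκ
  have hκne : κ ≠ 0 := hκ0.ne'
  -- ## the violating sequence
  set ε : ℝ := min 1 δ₀ with hεdef
  have hε0 : 0 < ε := lt_min one_pos hδ₀
  have hε1 : ε ≤ 1 := min_le_left _ _
  have hεδ : ε ≤ δ₀ := min_le_right _ _
  set δ : ℕ → ℝ := fun k => ε / ((k : ℝ) + 1) with hδdef
  have hδpos : ∀ k, 0 < δ k := fun k => by positivity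
  have hδle : ∀ k, δ k ≤ ε := fun k =>
    div_le_self hε0.le (by linarith [(Nat.cast_nonneg k : (0 : ℝ) ≤ k)])
  have hδlim : Tendsto δ atTop (𝓝 0) := Literature.Geometry.GeometricMeasureTheory.tendsto_const_div_add_one ε
  have hex : ∀ k : ℕ, ∃ t ∈ Ioo (T - δ k ^ 2) T, ∃ x ∈ ball a (δ k),
      ((k : ℝ) + 1) / (‖x - a‖ + Real.sqrt (T - t)) < ‖u t x‖ := fun k => hne _ _ (hδpos k)
  choose t ht x hx hbig using hex
  have hTt : ∀ k, 0 < T - t k := fun k => sub_pos.2 (ht k).2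
  have hsq : ∀ k, 0 < Real.sqrt (T - t k) := fun k => Real.sqrt_pos.2 (hTt k)
  set d : ℕ → ℝ := fun k => ‖x k - a‖ + Real.sqrt (T - t k) with hddef
  have hdpos : ∀ k, 0 < d k := fun k => add_pos_of_nonneg_of_pos (norm_nonneg _) (hsq k)
  have hbig' : ∀ k : ℕ, ((k : ℝ) + 1) < d k * ‖u (t k) (x k)‖ := fun k => by
    have h := hbig k
    rwa [div_lt_iff₀ (hdpos k), mul_comm] at h
  -- `t_k` lies in the rate window
  have htwin : ∀ k, t k ∈ Ioo (T - δ₀) T := fun k => by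
    refine ⟨?_, (ht k).2⟩
    have h1 := (ht k).1
    have h2 : δ k ^ 2 ≤ δ₀ :=
      calc δ k ^ 2 ≤ ε ^ 2 := pow_le_pow_left₀ (hδpos k).le (hδle k) 2
        _ ≤ ε := by nlinarith
        _ ≤ δ₀ := hεδ
    linarith
  -- ## the rate pushes the points outside the parabola: `√(T - t_k)/d_k ≤ C/(k+1)`
  have hratio : ∀ k : ℕ, Real.sqrt (T - t k) / d k ≤ C / ((k : ℝ) + 1) := fun k => by
    rw [div_le_div_iff₀ (hdpos k) (by positivity)]
    calc Real.sqrt (T - t k) * ((k : ℝ) + 1)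
        ≤ Real.sqrt (T - t k) * (d k * ‖u (t k) (x k)‖) :=
          mul_le_mul_of_nonneg_left (hbig' k).le (hsq k).le
      _ = d k * (Real.sqrt (T - t k) * ‖u (t k) (x k)‖) := by ring
      _ ≤ d k * C := mul_le_mul_of_nonneg_left (hrate (t k) (htwin k) (x k)) (hdpos k).le
      _ = C * d k := mul_comm _ _
  have hratio0 : ∀ k, 0 ≤ Real.sqrt (T - t k) / d k := fun k =>
    div_nonneg (Real.sqrt_nonneg _) (hdpos k).le
  -- ## scales `κ d_k`, rescaled times and points
  set Ls : ℕ → ℝ := fun k => κ * d k with hLsdef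
  have hLspos : ∀ k, 0 < Ls k := fun k => mul_pos hκ0 (hdpos k)
  set w : ℕ → (EuclideanSpace ℝ (Fin 3)) := fun k => (Ls k)⁻¹ • (x k - a) with hwdef
  set s : ℕ → ℝ := fun k => -((T - t k) / Ls k ^ 2) with hsdef
  have hzoom : ∀ k, zoom u a T (Ls k) (s k) (w k) = Ls k • u (t k) (x k) := fun k => by
    have hL := (hLspos k).ne'
    show Ls k • u (T + Ls k ^ 2 * (-((T - t k) / Ls k ^ 2))) (a + Ls k • (Ls k)⁻¹ • (x k - a)) = _
    congr 2
    · field_simp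
      ring
    · rw [smul_smul, mul_inv_cancel₀ hL, one_smul]
      abel
  have hbigzoom : ∀ k : ℕ, κ * ((k : ℝ) + 1) < ‖zoom u a T (Ls k) (s k) (w k)‖ := fun k => by
    rw [hzoom, norm_smul, Real.norm_of_nonneg (hLspos k).le]
    calc κ * ((k : ℝ) + 1) < κ * (d k * ‖u (t k) (x k)‖) :=
          mul_lt_mul_of_pos_left (hbig' k) hκ0
      _ = Ls k * ‖u (t k) (x k)‖ := by simp only [hLsdef]; ring
  have hw_eq : ∀ k, ‖w k‖ = κ⁻¹ - Real.sqrt (T - t k) / d k / κ := fun k => by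
    have hd := (hdpos k).ne'
    show ‖(Ls k)⁻¹ • (x k - a)‖ = _
    rw [norm_smul, norm_inv, Real.norm_of_nonneg (hLspos k).le,
      show ‖x k - a‖ = d k - Real.sqrt (T - t k) by simp only [hddef]; ring]
    show (κ * d k)⁻¹ * (d k - Real.sqrt (T - t k)) = _
    field_simp
  have hw_le : ∀ k, ‖w k‖ ≤ κ⁻¹ := fun k => by
    rw [hw_eq]
    linarith [div_nonneg (hratio0 k) hκ0.le]
  have hw_ge : ∀ k : ℕ, κ⁻¹ - C / ((k : ℝ) + 1) / κ ≤ ‖w k‖ := fun k => by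
    rw [hw_eq]
    linarith [div_le_div_of_nonneg_right (hratio k) hκ0.le]
  have hs_neg : ∀ k, s k < 0 := fun k =>
    neg_neg_of_pos (div_pos (hTt k) (pow_pos (hLspos k) 2))
  have hs_ge : ∀ k : ℕ, -((C / ((k : ℝ) + 1)) ^ 2 / κ ^ 2) ≤ s k := fun k => by
    have hd := (hdpos k).ne'
    have h2 : (Real.sqrt (T - t k) / d k) ^ 2 ≤ (C / ((k : ℝ) + 1)) ^ 2 :=
      pow_le_pow_left₀ (hratio0 k) (hratio k) 2
    have hs_eq : s k = -((Real.sqrt (T - t k) / d k) ^ 2 / κ ^ 2) := by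
      show -((T - t k) / (κ * d k) ^ 2) = _
      rw [div_pow, Real.sq_sqrt (hTt k).le]
      field_simp
    rw [hs_eq]
    linarith [div_le_div_of_nonneg_right h2 (pow_pos hκ0 2).le]
  -- ## limits: `s_k → 0⁻`, `‖w_k‖ → κ⁻¹`, `L_k → 0`
  have hCk : Tendsto (fun k : ℕ => C / ((k : ℝ) + 1)) atTop (𝓝 0) := Literature.Geometry.GeometricMeasureTheory.tendsto_const_div_add_one C
  have hs0 : Tendsto s atTop (𝓝 0) := by
    have hlow : Tendsto (fun k : ℕ => -((C / ((k : ℝ) + 1)) ^ 2 / κ ^ 2)) atTop (𝓝 0) := by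
      have h := ((hCk.pow 2).div_const (κ ^ 2)).neg
      simpa using h
    exact tendsto_of_tendsto_of_tendsto_of_le_of_le hlow tendsto_const_nhds hs_ge
      (fun k => (hs_neg k).le)
  have hwκ : Tendsto (fun k => ‖w k‖) atTop (𝓝 κ⁻¹) := by
    have hl : Tendsto (fun k : ℕ => κ⁻¹ - C / ((k : ℝ) + 1) / κ) atTop (𝓝 κ⁻¹) := by
      have h := (hCk.div_const κ).const_sub κ⁻¹
      simpa using h
    exact tendsto_of_tendsto_of_tendsto_of_le_of_le hl tendsto_const_nhds hw_ge hw_le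
  have hd0 : Tendsto d atTop (𝓝 0) := by
    have hdle : ∀ k, d k ≤ 2 * δ k := fun k => by
      have h1 : ‖x k - a‖ < δ k := by rw [← dist_eq_norm]; exact hx k
      have h2 : Real.sqrt (T - t k) < δ k := by
        rw [Real.sqrt_lt' (hδpos k)]
        linarith [(ht k).1]
      show ‖x k - a‖ + Real.sqrt (T - t k) ≤ 2 * δ k
      linarith
    have h2δ : Tendsto (fun k => 2 * δ k) atTop (𝓝 0) := by simpa using hδlim.const_mul 2
    exact tendsto_of_tendsto_of_tendsto_of_le_of_le tendsto_const_nhds h2δ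
      (fun k => (hdpos k).le) hdle
  have hLs0 : Tendsto Ls atTop (𝓝 0) := by simpa [hLsdef] using hd0.const_mul κ
  -- ## compactness of the rescaled points: `w (φ k) → z`, `‖z‖ = κ⁻¹`
  obtain ⟨z, -, φ, hφ, hwz⟩ := (isCompact_closedBall (0 : (EuclideanSpace ℝ (Fin 3))) κ⁻¹).tendsto_subseq
    (x := w) (fun k => mem_closedBall_zero_iff.2 (hw_le k))
  have hzκ : ‖z‖ = κ⁻¹ := tendsto_nhds_unique hwz.norm (hwκ.comp hφ.tendsto_atTop)
  have hz1 : ‖z‖ < 1 := (sphere_aux hκ hzκ).2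
  -- ## a tangent flow along a further subsequence (I1)
  have hc₀ := c₀_pos.ne'
  obtain ⟨ψ, hψ, ū, hū⟩ := i1_of_suitableCompactness hZ hB (fun k => Ls (φ k) / c₀)
    (fun k => div_pos (hLspos _) c₀_pos)
    (by simpa using (hLs0.comp hφ.tendsto_atTop).div_const c₀)
  have e : (fun k => c₀ * ((fun k => Ls (φ k) / c₀) ∘ ψ) k) = fun k => Ls (φ (ψ k)) := by
    funext k
    simp only [Function.comp_apply]
    field_simp
  have hū' : TangentU u p a T (fun k => Ls (φ (ψ k))) ū := by
    have h : TangentU u p a T (fun k => c₀ * ((fun k => Ls (φ k) / c₀) ∘ ψ) k) ū := hū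
    rwa [e] at h
  refine ⟨_, ū, hū', z, hzκ, fun hreg => ?_⟩
  -- ## were `ū` regular at `z`, L1 would bound the zooms near `(0, z)`; but they exceed `κ(k+1)`
  obtain ⟨ρ, hρ, A, hev⟩ := zoom_eventually_bdd_of_regPt hT hcont hZ hB hū' hz1 hreg
  have hφψ : Tendsto (fun k => φ (ψ k)) atTop atTop := hφ.tendsto_atTop.comp hψ.tendsto_atTop
  have h_s : ∀ᶠ k in atTop, s (φ (ψ k)) ∈ Ioo (-(ρ ^ 2)) 0 := by
    have hneg : -(ρ ^ 2) < 0 := by simpa using pow_pos hρ 2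
    have h1 : ∀ᶠ k in atTop, s (φ (ψ k)) ∈ Ioi (-(ρ ^ 2)) :=
      (hs0.comp hφψ).eventually_mem (Ioi_mem_nhds hneg)
    filter_upwards [h1] with k hk
    exact ⟨hk, hs_neg _⟩
  have h_w : ∀ᶠ k in atTop, w (φ (ψ k)) ∈ ball z ρ :=
    (hwz.comp hψ.tendsto_atTop).eventually_mem (ball_mem_nhds z hρ)
  have h_A : ∀ᶠ k in atTop, A < κ * (((φ (ψ k) : ℕ) : ℝ) + 1) := by
    have h1 : Tendsto (fun k => κ * (((φ (ψ k) : ℕ) : ℝ) + 1)) atTop atTop := by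
      refine Tendsto.const_mul_atTop hκ0 ?_
      exact Filter.tendsto_atTop_add_const_right _ 1 (tendsto_natCast_atTop_atTop.comp hφψ)
    exact h1.eventually_gt_atTop A
  obtain ⟨k, hk1, hk2, hk3, hk4⟩ := (hev.and (h_s.and (h_w.and h_A))).exists
  have h1 := hk1 _ hk2 _ hk3
  have h2 := hbigzoom (φ (ψ k))
  linarith

/-! #### M2. Tower frame: NOT ENVELOPED ⇒ sphere satellites in the tangent cone -/

/-- For a tower object and a final-time point `y'` where the local KNSS envelope FAILS, every sphere
`‖z‖ = κ⁻¹` (`κ > 1`) carries a satellite of some tangent flow of `U` at `(0, y')`. -/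
theorem TowerObj.sphere_of_not_envelope {M : ℝ} (h : TowerObj M U P) {y' : (EuclideanSpace ℝ (Fin 3))}
    (hne : ¬ ∃ A δ : ℝ, 0 < δ ∧ ∀ t ∈ Ioo (-(δ ^ 2)) 0, ∀ x ∈ ball y' δ,
      ‖U t x‖ ≤ A / (‖x - y'‖ + Real.sqrt (-t))) {κ : ℝ} (hκ : 1 < κ) :
    ∃ (L : ℕ → ℝ) (Ū : ℝ → (EuclideanSpace ℝ (Fin 3)) → (EuclideanSpace ℝ (Fin 3))), TangentU U P y' 0 L Ū ∧
      ∃ z : (EuclideanSpace ℝ (Fin 3)), ‖z‖ = κ⁻¹ ∧ ¬ RegPt Ū z := by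
  obtain ⟨hc, -, hZ, hB⟩ := h.inputs y'
  have hdec : HasTypeITimeDecay M U := h.2.2.1
  have hrate : ∀ t ∈ Ioo ((1 : ℝ) - 1) 1, ∀ x, Real.sqrt (1 - t) * ‖tshift U t x‖ ≤ M := by
    intro t ht x
    have ht' : t - 1 < 0 := by linarith [ht.2]
    have h1 := hdec (t - 1) ht' x
    have hs : 0 < Real.sqrt (-(t - 1)) := Real.sqrt_pos.2 (by linarith)
    rw [tshift_apply, show (1 : ℝ) - t = -(t - 1) by ring]
    rwa [le_div_iff₀ hs, mul_comm] at h1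
  have hne' : ¬ ∃ A δ : ℝ, 0 < δ ∧ ∀ t ∈ Ioo (1 - δ ^ 2) 1, ∀ x ∈ ball y' δ,
      ‖tshift U t x‖ ≤ A / (‖x - y'‖ + Real.sqrt (1 - t)) := by
    rintro ⟨A, δ, hδ, hAδ⟩
    refine hne ⟨A, δ, hδ, fun t ht x hx => ?_⟩
    have h1 := hAδ (t + 1) ⟨by linarith [ht.1], by linarith [ht.2]⟩ x hx
    rwa [tshift_apply, add_sub_cancel_right, show (1 : ℝ) - (t + 1) = -t by ring] at h1
  obtain ⟨L, Ū, hŪ, z, hz, hreg⟩ :=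
    exists_tangentU_sphere_of_not_envelope one_pos hc one_pos hrate hZ hB hne' hκ
  exact ⟨L, Ū, tangentU_tshift_iff.1 hŪ, z, hz, hreg⟩

/-! #### M3. ★ THE ROOT METER in the engine class: NON-TAME ⟺ SPHERE SATELLITE (every sphere) -/

/-- ★ **NON-TAME ⇒ A SATELLITE ON EVERY SPHERE OF THE TANGENT CONE.**  For an A–B object and a
final-time point `y'` where the slice budget FAILS, and every `κ > 1`, some tangent flow of `U` at
`(0, y')` has a satellite on the sphere `‖z‖ = κ⁻¹` (ROUND-32's ENVELOPED ⇒ TAME, contraposed, then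
M2). -/
theorem ABTower.sphere_of_not_budgetAt {M : ℝ} {H : ℝ → (EuclideanSpace ℝ (Fin 3)) → (EuclideanSpace ℝ (Fin 3)) →L[ℝ] (EuclideanSpace ℝ (Fin 3))}
    (h : ABTower M U P H) {y' : (EuclideanSpace ℝ (Fin 3))} (hb : ¬ BudgetAt 1 0 U y') {κ : ℝ} (hκ : 1 < κ) :
    ∃ (L : ℕ → ℝ) (Ū : ℝ → (EuclideanSpace ℝ (Fin 3)) → (EuclideanSpace ℝ (Fin 3))), TangentU U P y' 0 L Ū ∧
      ∃ z : (EuclideanSpace ℝ (Fin 3)), ‖z‖ = κ⁻¹ ∧ ¬ RegPt Ū z :=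
  (towerObj_of_abTower h).sphere_of_not_envelope
    (fun ⟨_, _, hδ, henv⟩ => hb (h.budgetAt_of_envelope hδ henv)) hκ

/-- ★ **THE ROOT METER (iff form).**  For an A–B object, ANY final-time point `y'` and ANY `κ > 1`:
the slice budget fails at `y'` IFF some tangent flow at `(0, y')` has a satellite ON THE SPHERE
`‖z‖ = κ⁻¹` (⟸: the class dictionary K6). -/
theorem ABTower.not_budgetAt_iff_sphere {M : ℝ} {H : ℝ → (EuclideanSpace ℝ (Fin 3)) → (EuclideanSpace ℝ (Fin 3)) →L[ℝ] (EuclideanSpace ℝ (Fin 3))} (h : ABTower M U P H)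
    (y' : (EuclideanSpace ℝ (Fin 3))) {κ : ℝ} (hκ : 1 < κ) :
    ¬ BudgetAt 1 0 U y' ↔ ∃ (L : ℕ → ℝ) (Ū : ℝ → (EuclideanSpace ℝ (Fin 3)) → (EuclideanSpace ℝ (Fin 3))), TangentU U P y' 0 L Ū ∧
      ∃ z : (EuclideanSpace ℝ (Fin 3)), ‖z‖ = κ⁻¹ ∧ ¬ RegPt Ū z := by
  refine ⟨fun hb => h.sphere_of_not_budgetAt hb hκ, ?_⟩
  rintro ⟨L, Ū, hŪ, z, hz, hreg⟩ hb
  exact hreg ((abTower_dictionary_inBall h y').1 hb L Ū hŪ z (sphere_aux hκ hz).1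
    (sphere_aux hκ hz).2)

/-- **NOT ENVELOPED ⟺ SPHERE SATELLITE** (the meter in the envelope's language, L7 + M3). -/
theorem ABTower.not_enveloped_iff_sphere {M : ℝ} {H : ℝ → (EuclideanSpace ℝ (Fin 3)) → (EuclideanSpace ℝ (Fin 3)) →L[ℝ] (EuclideanSpace ℝ (Fin 3))} (h : ABTower M U P H)
    (y' : (EuclideanSpace ℝ (Fin 3))) {κ : ℝ} (hκ : 1 < κ) :
    (¬ ∃ A δ : ℝ, 0 < δ ∧ ∀ t ∈ Ioo (-(δ ^ 2)) 0, ∀ x ∈ ball y' δ,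
        ‖U t x‖ ≤ A / (‖x - y'‖ + Real.sqrt (-t))) ↔
      ∃ (L : ℕ → ℝ) (Ū : ℝ → (EuclideanSpace ℝ (Fin 3)) → (EuclideanSpace ℝ (Fin 3))), TangentU U P y' 0 L Ū ∧
        ∃ z : (EuclideanSpace ℝ (Fin 3)), ‖z‖ = κ⁻¹ ∧ ¬ RegPt Ū z := by
  exact (not_congr (h.budgetAt_iff_enveloped y')).symm.trans (h.not_budgetAt_iff_sphere y' hκ)

/-- **SPHERE RIGIDITY of the tangent cone**: if SOME tangent flow at `(0, y')` has SOME satellite in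
the punctured open unit ball, then for EVERY `κ > 1` some tangent flow at `(0, y')` has a satellite
on the sphere `‖z‖ = κ⁻¹`. -/
theorem ABTower.sphere_filling {M : ℝ} {H : ℝ → (EuclideanSpace ℝ (Fin 3)) → (EuclideanSpace ℝ (Fin 3)) →L[ℝ] (EuclideanSpace ℝ (Fin 3))} (h : ABTower M U P H) {y' : (EuclideanSpace ℝ (Fin 3))}
    {L : ℕ → ℝ} {Ū : ℝ → (EuclideanSpace ℝ (Fin 3)) → (EuclideanSpace ℝ (Fin 3))} (hŪ : TangentU U P y' 0 L Ū) {z : (EuclideanSpace ℝ (Fin 3))} (hz0 : z ≠ 0)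
    (hz1 : ‖z‖ < 1) (hreg : ¬ RegPt Ū z) {κ : ℝ} (hκ : 1 < κ) :
    ∃ (L' : ℕ → ℝ) (Ū' : ℝ → (EuclideanSpace ℝ (Fin 3)) → (EuclideanSpace ℝ (Fin 3))), TangentU U P y' 0 L' Ū' ∧
      ∃ z' : (EuclideanSpace ℝ (Fin 3)), ‖z'‖ = κ⁻¹ ∧ ¬ RegPt Ū' z' :=
  h.sphere_of_not_budgetAt
    (fun hb => hreg ((abTower_dictionary_inBall h y').1 hb L Ū hŪ z hz0 hz1)) hκ

/-! #### M4. TAME ⇒ ISOLATED: a tame point is an isolated point of the field's OWN final-time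
singular set; accumulation of satellites forces sphere-filling tangent flows -/

/-- A local space–time envelope at `(0, y')` makes every final-time point `(0, y)` with
`0 < ‖y − y'‖ < δ/2` regular (bound `A/r` on `Q_r(0, y)`, `r = ‖y − y'‖/2`). -/
theorem regPt_of_localEnvelope {y' : (EuclideanSpace ℝ (Fin 3))} {A δ : ℝ} (hδ : 0 < δ)
    (henv : ∀ t ∈ Ioo (-(δ ^ 2)) 0, ∀ x ∈ ball y' δ, ‖U t x‖ ≤ A / (‖x - y'‖ + Real.sqrt (-t)))
    {y : (EuclideanSpace ℝ (Fin 3))} (hy0 : y ≠ y') (hyδ : ‖y - y'‖ < δ / 2) : RegPt U y := by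
  have hyy : 0 < ‖y - y'‖ := norm_pos_iff.2 (sub_ne_zero.2 hy0)
  set r : ℝ := ‖y - y'‖ / 2 with hr
  have hr0 : 0 < r := by positivity
  have hrδ : r < δ / 4 := by rw [hr]; linarith
  refine ⟨r, hr0, A / r,
    (ae_restrict_mem (isOpen_parabolicCylinder _ _).measurableSet).mono fun z hz => ?_⟩
  rw [mem_parabolicCylinder] at hz
  obtain ⟨⟨hz1, hz2⟩, hz3⟩ := hz
  have ht : z.1 < 0 := by simpa using hz2
  have ht1 : -(r ^ 2) < z.1 := by simpa using hz1
  have hdist : dist z.2 y < r := by simpa using hz3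
  have htwin : z.1 ∈ Ioo (-(δ ^ 2)) 0 := by
    refine ⟨lt_trans ?_ ht1, ht⟩
    have hrltδ : r < δ := by linarith
    have : r ^ 2 < δ ^ 2 := by nlinarith
    linarith
  have hxy' : ‖z.2 - y'‖ < 3 * r := by
    calc ‖z.2 - y'‖ = dist z.2 y' := (dist_eq_norm _ _).symm
      _ ≤ dist z.2 y + dist y y' := dist_triangle _ _ _
      _ < r + ‖y - y'‖ := by rw [dist_eq_norm y y']; linarith
      _ = 3 * r := by rw [hr]; ring
  have hxball : z.2 ∈ ball y' δ := by
    rw [mem_ball, dist_eq_norm]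
    linarith
  have hlow : r ≤ ‖z.2 - y'‖ + Real.sqrt (-z.1) := by
    have h1 : ‖y - y'‖ - ‖z.2 - y‖ ≤ ‖z.2 - y'‖ := by
      have := norm_sub_norm_le (y - y') (y - z.2)
      rw [show y - y' - (y - z.2) = z.2 - y' by abel, norm_sub_rev y z.2] at this
      linarith
    have h2 : ‖z.2 - y‖ < r := by rwa [← dist_eq_norm]
    have h3 : ‖y - y'‖ = 2 * r := by rw [hr]; ring
    linarith [Real.sqrt_nonneg (-z.1)]
  have h1 := henv z.1 htwin z.2 hxball
  have hden : 0 < ‖z.2 - y'‖ + Real.sqrt (-z.1) := lt_of_lt_of_le hr0 hlow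
  have hA : 0 ≤ A := by
    by_contra hA
    push Not at hA
    exact absurd ((norm_nonneg _).trans h1) (not_le.2 (div_neg_of_neg_of_pos hA hden))
  exact h1.trans (div_le_div_of_nonneg_left hA hr0 hlow)

end Tower

end Summit.NavierStokesRegularity.NavierStokesRegularity.Cruxes.ScarEnvelopeTypeI.ZoomDictionary
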